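import Literature.MathematicalPhysics.QuantumLattice.SectorisedIncrementBoundGradedWeightedPrescribedPlateau
import HarnessLib

/-!
# The weighted oriented bridge: levelled anchored norms of the sector preimage from sectorised prescribed sums

Topic `Literature/MathematicalPhysics/QuantumLattice`; companion of `SectorisedKernelNormPrescribedBridge` and of §2 of
`SectorisedIncrementBoundGradedWeightedPrescribedPlateau` (Benfatto–Giuliani–Mastropietro 2006, §2.7 (2.70), §2.8 (2.88)–(2.90) and
(2.97)–(2.98), App. A3 Lemma A3.1, App. A4 (A4.8)).  The oriented Grassmann suppliers
(`…GradedTruncationOrientedDB`, `SectorisedIncrementBoundGradedWeightedOrientedGeneric`) ask the input through LEVELLED weighted anchored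
norms indexed by a restriction pattern `ρc : legs → Option sector`: (`hN`) one further free leg pinned fully, level `#dom ρc + 1`; (`hNsw`)
the same leg pinned in POSITION only, its sector summed, level `#dom ρc`.  Here both are discharged, for the kernels of the sector preimage
`K = kernel (sectorPreimage β F G) (m+1)` (`= ε_x^{m+1} W_{F,σ}(x)` at `Y = (x_i, σ_i)_i`), from bounds on the sectorised prescribed sums:

* `sum_wt_restr_norm_kernel_sectorPreimage_le_of_wt_prescribedSum_le` — full pin: from
  `ε_x^m Σ_{σ|_E = τ} Σ_{x_p = y} wl·‖W_σ(x)‖ ≤ B` (`|E| = F + 1 ∋ p`), the `ρc`-restricted pinned sum is `≤ ε_x · B`;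
* `exists_sectorSum_bound_kernel_sectorPreimage_of_wt_swPrescribedSum_le` — position-only pin: from
  `ε_x^m Σ_{σ|_E = τ} Σ_{x_t = y(σ_t)} wl·‖W_σ(x)‖ ≤ B′` (`|E| = F ∌ t`, every choice `y : sector → position` of the pinned position per
  sector of the pinned leg — for translation-invariant kernels the choice is immaterial), there are `g(σ₀) ≥ 0` with the restricted
  sums pinned at `(y, σ₀)` at most `g(σ₀)` and `Σ_{σ₀} g(σ₀) ≤ ε_x · B′`.

Everything is proved; no definition, no named fact.

## Sources

G. Benfatto, A. Giuliani, V. Mastropietro, Ann. Henri Poincaré 7 (2006) 809–898, §2.7 (2.70), §2.8 (2.88)–(2.90), (2.97)–(2.98),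
App. A3 Lemma A3.1, App. A4 (A4.8) (`BenfattoGiulianiMastropietro2006`).
-/

noncomputable section

namespace Literature.MathematicalPhysics.QuantumLattice

open GrassmannAlgebra Finset Literature.Probability.LatticeModels

section Hubbard

variable {L M : ℕ} [NeZero L] [NeZero M] {N : ℕ}

omit [NeZero L] [NeZero M] in
/-- The restriction indicator of a pattern `ρc` is the product of the slot indicators over its domain. [folklore] -/
private theorem ite_restr_eq_mul_prod {m : ℕ} (ρc : Fin (m + 1) → Option (SectorLeg N)) (Y : Fin (m + 1) → SpaceTimeIdx L M × SectorLeg N)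
    (v : ℝ) :
    (if ∀ j' σ, ρc j' = some σ → (Y j').2 = σ then v else 0) =
      v * ∏ j : (univ.filter fun j' : Fin (m + 1) => ρc j' ≠ none),
        (if (Y (j : Fin (m + 1))).2 = (ρc j).get (Option.isSome_iff_ne_none.2 (mem_filter.1 j.2).2) then (1 : ℝ) else 0) := by
  classical
  rw [Finset.prod_boole]
  have hiff : (∀ j' σ, ρc j' = some σ → (Y j').2 = σ) ↔
      ∀ j ∈ (univ : Finset (univ.filter fun j' : Fin (m + 1) => ρc j' ≠ none)),
        (Y (j : Fin (m + 1))).2 = (ρc j).get (Option.isSome_iff_ne_none.2 (mem_filter.1 j.2).2) := by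
    constructor
    · intro h j _
      exact h _ _ (Option.some_get _).symm
    · intro h j' σ hσ
      have hj' : j' ∈ univ.filter (fun j' : Fin (m + 1) => ρc j' ≠ none) := mem_filter.2 ⟨mem_univ _, by rw [hσ]; simp⟩
      have h1 := h ⟨j', hj'⟩ (mem_univ _)
      rw [h1]
      exact Option.some_injective _ (by rw [Option.some_get]; exact hσ)
  by_cases h : ∀ j' σ, ρc j' = some σ → (Y j').2 = σ
  · rw [if_pos h, if_pos (hiff.1 h), mul_one]
  · rw [if_neg h, if_neg fun h' => h (hiff.2 h'), mul_zero]

omit [NeZero M] in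
/-- **THE WEIGHTED ORIENTED BRIDGE, FULL PIN**: if for every leg set `E ∋ p` with `|E| = F + 1` and every prescription `τ`,
`ε_x^m Σ_{σ : σ|_E = τ|_E} Σ_{x : x_p = y} wl((x_i, σ_i)_i)·‖W_{F,σ}(x)‖ ≤ B`, then for every restriction pattern `ρc` with `#dom ρc = F`,
every free leg `t` and every pin `a`,
`Σ_{Y : Y t = a} [Y respects ρc]·‖kernel (sectorPreimage β F G) (m+1) Y‖·wl(Y) ≤ ε_x · B` — the `hN` input of the oriented Grassmann suppliers.
[cite: BenfattoGiulianiMastropietro2006, §2.8 (2.88)-(2.90) and (2.97)-(2.98), App. A3 Lemma A3.1] -/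
theorem sum_wt_restr_norm_kernel_sectorPreimage_le_of_wt_prescribedSum_le {β : ℝ} (hβ : 0 ≤ β)
    (F : Fin N → FreqMomentum L M → ℂ) (G : HubbardGrassmann L M) (wl : Finset (SpaceTimeIdx L M × SectorLeg N) → ℝ) (hwl : ∀ S, 0 ≤ wl S)
    (m : ℕ) {Fc : ℕ} {B : ℝ}
    (hB : ∀ (E : Finset (Fin (m + 1))) (τ : Fin (m + 1) → SectorLeg N) (p : Fin (m + 1)), p ∈ E → E.card = Fc + 1 →
      ∀ y : SpaceTimeIdx L M,
        imagTimeWeight β M ^ m * ∑ σ ∈ univ.filter (fun σ : Fin (m + 1) → SectorLeg N => ∀ e ∈ E, σ e = τ e),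
          ∑ x ∈ univ.filter (fun x : Fin (m + 1) → SpaceTimeIdx L M => x p = y),
            wl (univ.image fun i => (x i, σ i)) * ‖sectorisedKernel L M β F G (m + 1) σ x‖ ≤ B)
    (ρc : Fin (m + 1) → Option (SectorLeg N)) (hFc : (univ.filter fun j' : Fin (m + 1) => ρc j' ≠ none).card = Fc)
    (t : Fin (m + 1)) (ht : ρc t = none) (a : SpaceTimeIdx L M × SectorLeg N) :
    ∑ Y ∈ univ.filter (fun Y : Fin (m + 1) → SpaceTimeIdx L M × SectorLeg N => Y t = a),
        (if ∀ j' σ, ρc j' = some σ → (Y j').2 = σ then ‖kernel ℂ (sectorPreimage β F G) (m + 1) Y‖ * wl (univ.image Y) else 0) ≤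
      imagTimeWeight β M * B := by
  classical
  set D := univ.filter (fun j' : Fin (m + 1) => ρc j' ≠ none) with hD
  set s : D → SectorLeg N := fun j => (ρc j).get (Option.isSome_iff_ne_none.2 (mem_filter.1 j.2).2) with hs
  have hDt : ∀ j : D, (j : Fin (m + 1)) ≠ t := fun j h => (mem_filter.1 j.2).2 (by rw [h]; exact ht)
  calc ∑ Y ∈ univ.filter (fun Y : Fin (m + 1) → SpaceTimeIdx L M × SectorLeg N => Y t = a),
          (if ∀ j' σ, ρc j' = some σ → (Y j').2 = σ then ‖kernel ℂ (sectorPreimage β F G) (m + 1) Y‖ * wl (univ.image Y) else 0)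
      = ∑ Y ∈ univ.filter (fun Y : Fin (m + 1) → SpaceTimeIdx L M × SectorLeg N => Y t = a),
          ‖kernel ℂ (sectorPreimage β F G) (m + 1) Y‖ * wl (univ.image Y) *
            ∏ j : D, (if (Y (j : Fin (m + 1))).2 = s j then (1 : ℝ) else 0) :=
        sum_congr rfl fun Y _ => ite_restr_eq_mul_prod ρc Y _
    _ ≤ imagTimeWeight β M * B :=
        sum_wt_norm_kernel_sectorPreimage_prescribedSlots_le_of_wt_prescribedSum_le hβ F G wl hwl m hB D hFc
          (fun j : D => (j : Fin (m + 1))) (fun j j' h => Subtype.ext h) t hDt s a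

/-- **THE WEIGHTED ORIENTED BRIDGE, POSITION-ONLY PIN** (BGM 2006 App. A4 (A4.8): the child end of a swapped line is pinned in position, its
sector summed).  If for every leg set `E` with `|E| = F`, every leg `t ∉ E`, every prescription `τ` and every choice `y : sector → position`,
`ε_x^m Σ_{σ : σ|_E = τ|_E} Σ_{x : x_t = y(σ_t)} wl((x_i, σ_i)_i)·‖W_{F,σ}(x)‖ ≤ B′`, then for every restriction pattern `ρc` with `#dom ρc = F`
and every free leg `t` there are `g(σ₀) ≥ 0` (`σ₀` the sector of the pinned leg) with
`Σ_{Y : Y t = (y, σ₀)} [Y respects ρc]·‖kernel (sectorPreimage β F G) (m+1) Y‖·wl(Y) ≤ g(σ₀)` for all `y` and `Σ_{σ₀} g(σ₀) ≤ ε_x · B′` —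
the `hNsw` input of the oriented Grassmann suppliers. [cite: BenfattoGiulianiMastropietro2006, App. A4 (A4.8), §2.8 (2.88)-(2.90), App. A3 Lemma A3.1] -/
theorem exists_sectorSum_bound_kernel_sectorPreimage_of_wt_swPrescribedSum_le {β : ℝ} (hβ : 0 ≤ β)
    (F : Fin N → FreqMomentum L M → ℂ) (G : HubbardGrassmann L M) (wl : Finset (SpaceTimeIdx L M × SectorLeg N) → ℝ) (hwl : ∀ S, 0 ≤ wl S)
    (m : ℕ) {Fc : ℕ} {B' : ℝ} (σdef : SectorLeg N)
    (hB' : ∀ (E : Finset (Fin (m + 1))) (τ : Fin (m + 1) → SectorLeg N) (t : Fin (m + 1)), t ∉ E → E.card = Fc →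
      ∀ yσ : SectorLeg N → SpaceTimeIdx L M,
        imagTimeWeight β M ^ m * ∑ σ ∈ univ.filter (fun σ : Fin (m + 1) → SectorLeg N => ∀ e ∈ E, σ e = τ e),
          ∑ x ∈ univ.filter (fun x : Fin (m + 1) → SpaceTimeIdx L M => x t = yσ (σ t)),
            wl (univ.image fun i => (x i, σ i)) * ‖sectorisedKernel L M β F G (m + 1) σ x‖ ≤ B')
    (ρc : Fin (m + 1) → Option (SectorLeg N)) (hFc : (univ.filter fun j' : Fin (m + 1) => ρc j' ≠ none).card = Fc)
    (t : Fin (m + 1)) (ht : ρc t = none) :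
    ∃ g : SectorLeg N → ℝ, (∀ σ₀, 0 ≤ g σ₀) ∧
      (∀ a : SpaceTimeIdx L M × SectorLeg N,
        ∑ Y ∈ univ.filter (fun Y : Fin (m + 1) → SpaceTimeIdx L M × SectorLeg N => Y t = a),
          (if ∀ j' σ, ρc j' = some σ → (Y j').2 = σ then ‖kernel ℂ (sectorPreimage β F G) (m + 1) Y‖ * wl (univ.image Y) else 0) ≤
          g a.2) ∧
      ∑ σ₀, g σ₀ ≤ imagTimeWeight β M * B' := by
  classical
  have hε : 0 ≤ imagTimeWeight β M := imagTimeWeight_nonneg hβ M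
  set D := univ.filter (fun j' : Fin (m + 1) => ρc j' ≠ none) with hD
  set s : D → SectorLeg N := fun j => (ρc j).get (Option.isSome_iff_ne_none.2 (mem_filter.1 j.2).2) with hs
  have hDt : ∀ j : D, (j : Fin (m + 1)) ≠ t := fun j h => (mem_filter.1 j.2).2 (by rw [h]; exact ht)
  have htD : t ∉ D := fun h => (mem_filter.1 h).2 ht
  -- the pinned restricted sum as a function of the pin
  set S : SectorLeg N → SpaceTimeIdx L M → ℝ := fun σ₀ y =>
    ∑ Y ∈ univ.filter (fun Y : Fin (m + 1) → SpaceTimeIdx L M × SectorLeg N => Y t = (y, σ₀)),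
      (if ∀ j' σ, ρc j' = some σ → (Y j').2 = σ then ‖kernel ℂ (sectorPreimage β F G) (m + 1) Y‖ * wl (univ.image Y) else 0)
    with hSdef
  have hS0 : ∀ σ₀ y, 0 ≤ S σ₀ y := fun σ₀ y => sum_nonneg fun Y _ => by
    split_ifs; exacts [mul_nonneg (norm_nonneg _) (hwl _), le_rfl]
  -- the weighted kernel in sectorised currency
  set W' : (Fin (m + 1) → SectorLeg N) → (Fin (m + 1) → SpaceTimeIdx L M) → ℂ :=
    fun σ x => ((imagTimeWeight β M ^ (m + 1) * (‖sectorisedKernel L M β F G (m + 1) σ x‖ * wl (univ.image fun i => (x i, σ i))) : ℝ) : ℂ)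
    with hW'
  have hW'norm : ∀ σ x, ‖W' σ x‖ =
      imagTimeWeight β M ^ (m + 1) * (wl (univ.image fun i => (x i, σ i)) * ‖sectorisedKernel L M β F G (m + 1) σ x‖) := by
    intro σ x
    rw [hW']; dsimp only
    rw [Complex.norm_real, Real.norm_of_nonneg (mul_nonneg (pow_nonneg hε _) (mul_nonneg (norm_nonneg _) (hwl _))), mul_comm (wl _)]
  have hY : ∀ Y : Fin (m + 1) → SpaceTimeIdx L M × SectorLeg N,
      ‖kernel ℂ (sectorPreimage β F G) (m + 1) Y‖ * wl (univ.image Y) = ‖W' (fun i => (Y i).2) (fun i => (Y i).1)‖ := by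
    intro Y
    rw [kernel_sectorPreimage_eq_sectorisedKernel β F G (m + 1) Y, norm_mul, norm_pow, Complex.norm_real, Real.norm_of_nonneg hε, hW'norm]
    have himg : (univ.image fun i => ((Y i).1, (Y i).2)) = univ.image Y := by simp only [Prod.mk.eta]
    rw [himg]
    ring
  -- the pinned restricted sum in sectorised currency
  have hSeq : ∀ σ₀ y, S σ₀ y = ∑ σ ∈ univ.filter (fun σ : Fin (m + 1) → SectorLeg N => σ t = σ₀ ∧ ∀ j : D, σ (j : Fin (m + 1)) = s j),
      ∑ x ∈ univ.filter (fun x : Fin (m + 1) → SpaceTimeIdx L M => x t = y), ‖W' σ x‖ := by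
    intro σ₀ y
    rw [hSdef]
    dsimp only
    rw [← sum_norm_prescribedSlots_eq W' D (fun j : D => (j : Fin (m + 1))) s t (y, σ₀)]
    refine sum_congr rfl fun Y _ => ?_
    rw [ite_restr_eq_mul_prod ρc Y _, hY]
  -- the maximising pin position per sector
  have hmax : ∀ σ₀ : SectorLeg N, ∃ y ∈ (univ : Finset (SpaceTimeIdx L M)), ∀ y' ∈ (univ : Finset (SpaceTimeIdx L M)), S σ₀ y' ≤ S σ₀ y :=
    fun σ₀ => exists_max_image univ (S σ₀) univ_nonempty
  choose ystar _ hystar using hmax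
  refine ⟨fun σ₀ => S σ₀ (ystar σ₀), fun σ₀ => hS0 _ _, fun a => ?_, ?_⟩
  · have h := hystar a.2 a.1 (mem_univ _)
    rw [hSdef] at h
    exact h
  -- the sum over the sector of the pinned leg
  set τ : Fin (m + 1) → SectorLeg N := fun e => if h : e ∈ D then s ⟨e, h⟩ else σdef with hτ
  have hfilt : univ.filter (fun σ : Fin (m + 1) → SectorLeg N => ∀ j : D, σ (j : Fin (m + 1)) = s j) =
      univ.filter (fun σ : Fin (m + 1) → SectorLeg N => ∀ e ∈ D, σ e = τ e) := by
    refine filter_congr fun σ _ => ⟨fun h e he => ?_, fun h j => ?_⟩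
    · rw [h ⟨e, he⟩, hτ]; dsimp only; rw [dif_pos he]
    · rw [h j j.2, hτ]; dsimp only; rw [dif_pos j.2]
  calc ∑ σ₀, S σ₀ (ystar σ₀)
      = ∑ σ₀, ∑ σ ∈ univ.filter (fun σ : Fin (m + 1) → SectorLeg N => σ t = σ₀ ∧ ∀ j : D, σ (j : Fin (m + 1)) = s j),
          ∑ x ∈ univ.filter (fun x : Fin (m + 1) → SpaceTimeIdx L M => x t = ystar (σ t)), ‖W' σ x‖ := by
        refine sum_congr rfl fun σ₀ _ => ?_
        rw [hSeq]
        refine sum_congr rfl fun σ hσ => ?_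
        rw [(mem_filter.1 hσ).2.1]
    _ = ∑ σ ∈ univ.filter (fun σ : Fin (m + 1) → SectorLeg N => ∀ j : D, σ (j : Fin (m + 1)) = s j),
          ∑ x ∈ univ.filter (fun x : Fin (m + 1) → SpaceTimeIdx L M => x t = ystar (σ t)), ‖W' σ x‖ := by
        rw [← sum_fiberwise (univ.filter fun σ : Fin (m + 1) → SectorLeg N => ∀ j : D, σ (j : Fin (m + 1)) = s j) (fun σ => σ t)]
        refine sum_congr rfl fun σ₀ _ => sum_congr ?_ fun _ _ => rfl
        ext σ
        simp only [mem_filter, mem_univ, true_and]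
        tauto
    _ = imagTimeWeight β M * (imagTimeWeight β M ^ m *
          ∑ σ ∈ univ.filter (fun σ : Fin (m + 1) → SectorLeg N => ∀ e ∈ D, σ e = τ e),
            ∑ x ∈ univ.filter (fun x : Fin (m + 1) → SpaceTimeIdx L M => x t = ystar (σ t)),
              wl (univ.image fun i => (x i, σ i)) * ‖sectorisedKernel L M β F G (m + 1) σ x‖) := by
        rw [hfilt, mul_sum, mul_sum]
        refine sum_congr rfl fun σ _ => ?_
        rw [mul_sum, mul_sum]
        refine sum_congr rfl fun x _ => ?_
        rw [hW'norm]
        ring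
    _ ≤ imagTimeWeight β M * B' := mul_le_mul_of_nonneg_left (hB' D τ t htD hFc ystar) hε

end Hubbard

end Literature.MathematicalPhysics.QuantumLattice
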